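import Literature.NumberTheory.NumberFields.NFIsoLocalFactorsCap
import Literature.Computability.Complexity.IrreducibilityLLLGcdFP
import Literature.Computability.Complexity.IrreducibilityLLLBerlekampFP
import HarnessLib

/-!
# Complete factorisation modulo `ℓ` runs in polynomial time (`CodeFP`), given Berlekamp on codes

Support file for the discharge of the named fact
`Literature.NumberTheory.NumberFields.nfIso_mem_P` (number-field isomorphism is in `P`;
Landau 1985, A. K. Lenstra 1983 Thm. (3.7)). Machine side of `NFIsoLocalFactorsCap.lean`, in the
typed `FP` algebra `CodeFP`: the capped extraction loop `localFactorsCap ℓ⁺ f` (`ℓ⁺ = max ℓ 2`,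
`ℓ` unary, as in the tree's `IrreducibilityLLL*FP.lean`) is a `CodeFP.foldl` over `|f|` ticks
whose accumulator `(W, acc)` is polynomially bounded on EVERY input by the unconditional
invariants of that file (`W` is `f` or reduced and not longer than `f`; `acc` holds at most one
reduced factor of length `≤ |f|` per tick). The one external ingredient is Berlekamp's algorithm on
codes, `(ℓ, W) ↦ berlekampFactor ℓ⁺ W` (tree, `IrreducibilityLLLBerlekampFP.berlekampFactorC`, from
the `lll_monicIrreducible_mem_P` development); the loop is proved for any such brick (`hB`) and
then instantiated:

* `capListC`, `lfStepCapC_of hB`, `localFactorsCapC_of hB`, and **`localFactorsCapC`**: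
  `CodeFP (pairE unE L) (rawE L) (fun t => localFactorsCap (max t.1 2) t.2)`.

## References

* S. Arora, B. Barak, *Computational Complexity: A Modern Approach*, CUP 2009, §1.3 (closure of
  polynomial time under composition and polynomially bounded loops). [AroraBarak2009]
* A. K. Lenstra, H. W. Lenstra Jr., L. Lovász, Math. Ann. 261 (1982), §3, (3.1). [LenstraLenstraLovasz1982]
-/

open Polynomial

namespace Literature.NumberTheory.NumberFields

open Literature.Computability.Complexity Literature.Computability.Complexity.CodeFP
open Literature.Computability.Complexity.SumcheckMA Literature.Computability.Complexity.LLLFactoring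

/-- The encoder of coefficient lists. -/
local notation "L" => rawE intE

/-- The encoder of the loop state `(W, acc)`. -/
local notation "LS" => pairE (rawE intE) (rawE (rawE intE))

/-! ### The step on codes -/

/-- **`capList P k l` on codes** (`P` binary, `k` unary). [cite: AroraBarak2009, §1.3] -/
theorem capListC : CodeFP (pairE natE (pairE unE L)) L (fun t => capList t.1 t.2.1 t.2.2) :=
  ((rawTakeUn intE).comp ((snd _ _).fst'.pair (pnormC.comp ((fst _ _).pair (snd _ _).snd')))).congr fun _ => rfl

/-- **One capped extraction step on codes**, given Berlekamp's algorithm on codes.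
[cite: LenstraLenstraLovasz1982, (3.1)] [cite: AroraBarak2009, §1.3] -/
theorem lfStepCapC_of (hB : CodeFP (pairE unE L) L (fun t => berlekampFactor (max t.1 2) t.2)) :
    CodeFP (pairE unE LS) LS (fun t => lfStepCap (max t.1 2) t.2) := by
  have hp : CodeFP (pairE unE LS) unE (fun t => t.1) := fst _ _
  have hP : CodeFP (pairE unE LS) natE (fun t => max t.1 2) := (maxTwoUnC.comp hp :)
  have hW : CodeFP (pairE unE LS) L (fun t => t.2.1) := (snd _ _).fst'
  have hacc : CodeFP (pairE unE LS) (rawE L) (fun t => t.2.2) := (snd _ _).snd'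
  have hlen : CodeFP (pairE unE LS) unE (fun t => t.2.1.length) := ((ulength intE).comp hW :)
  have htest : CodeFP (pairE unE LS) bitE (fun t => decide (t.2.1.length < 2)) :=
    (natLt.comp ((natOfUn.comp hlen).pair (const _ 2)) :)
  have hu : CodeFP (pairE unE LS) L (fun t => capList (max t.1 2) t.2.1.length (berlekampFactor (max t.1 2) t.2.1)) :=
    (capListC.comp (hP.pair (hlen.pair (hB.comp (hp.pair hW)))) :)
  have hqr : CodeFP (pairE unE LS) (pairE L L)
      (fun t => pdivmod (max t.1 2) t.2.1 (capList (max t.1 2) t.2.1.length (berlekampFactor (max t.1 2) t.2.1))) :=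
    (pdivmodC.comp ((natOfUn.comp hp).pair (hW.pair hu))).congr fun _ => rfl
  have hq : CodeFP (pairE unE LS) L
      (fun t => capList (max t.1 2) t.2.1.length (pdivmod (max t.1 2) t.2.1 (capList (max t.1 2) t.2.1.length (berlekampFactor (max t.1 2) t.2.1))).1) :=
    (capListC.comp (hP.pair (hlen.pair hqr.fst')) :)
  have hact : CodeFP (pairE unE LS) LS
      (fun t => (capList (max t.1 2) t.2.1.length (pdivmod (max t.1 2) t.2.1 (capList (max t.1 2) t.2.1.length (berlekampFactor (max t.1 2) t.2.1))).1,
        capList (max t.1 2) t.2.1.length (berlekampFactor (max t.1 2) t.2.1) :: t.2.2)) :=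
    (hq.pair ((rawCons L).comp (hu.pair hacc)) :)
  refine (htest.ite (snd _ _) hact).congr fun t => ?_
  obtain ⟨p, W, acc⟩ := t
  by_cases h : W.length < 2
  · simp [lfStepCap, h]
  · simp [lfStepCap, h]

/-! ### The accumulator estimate and the fold -/

/-- Code length of the list of collected factors: each is reduced and of length `≤ Lc`, and there
are at most `Lc` of them. [folklore] -/
theorem length_code_factors_le {p Lc : ℕ} {acc : List (List ℤ)}
    (hacc : ∀ u ∈ acc, Reduced (max p 2) u ∧ u.length ≤ Lc) (hn : acc.length ≤ Lc) (hp : p ≤ Lc) :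
    (rawE L acc).length ≤ Lc * (60 * (Lc + 1) ^ 4 + 2) := by
  rw [length_rawE]
  have hitem : ∀ x ∈ acc.map (fun u => 2 * (rawE intE u).length + 2), x ≤ 60 * (Lc + 1) ^ 4 + 2 := by
    intro x hx
    obtain ⟨u, hu, rfl⟩ := List.mem_map.1 hx
    obtain ⟨hred, hlen⟩ := hacc u hu
    have := length_code_state_le hred (hlen.trans (by nlinarith)) hp
    omega
  refine (List.sum_le_card_nsmul _ _ hitem).trans ?_
  rw [List.length_map, smul_eq_mul]
  exact Nat.mul_le_mul_right _ hn

/-- **The capped complete factorisation modulo `ℓ⁺` on codes**, given Berlekamp's algorithm on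
codes: `(ℓ, f) ↦ localFactorsCap (max ℓ 2) f` (`ℓ` unary) — a fold over `|f|` ticks with the
accumulator bound `130 (Lc+1)⁵`. [cite: LenstraLenstraLovasz1982, (3.1)] [cite: AroraBarak2009, §1.3] -/
theorem localFactorsCapC_of (hB : CodeFP (pairE unE L) L (fun t => berlekampFactor (max t.1 2) t.2)) :
    CodeFP (pairE unE L) (rawE L) (fun t => localFactorsCap (max t.1 2) t.2) := by
  have hstep : CodeFP (pairE (pairE unE L) (pairE unitE LS)) LS (fun t => lfStepCap (max t.1.1 2) t.2.2) :=
    ((lfStepCapC_of hB).comp ((fst _ _).fst'.pair (snd _ _).snd') :)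
  have hinit : CodeFP (pairE unE L) LS (fun s => (s.2, ([] : List (List ℤ)))) := ((snd _ _).pair (const _ ([] : List (List ℤ))) :)
  have hfold := foldl (σ := ℕ × List ℤ) (α := Unit) (β := List ℤ × List (List ℤ)) (eσ := pairE unE L) (eα := unitE)
    (eβ := LS) (step := fun s _ st => lfStepCap (max s.1 2) st) (init := fun s => (s.2, ([] : List (List ℤ)))) hstep hinit
    (130 * (X + 1) ^ 5) (fun s l₁ l₂ => by
      obtain ⟨p, f⟩ := s
      change (pairE L (rawE L) (l₁.foldl (fun st (_ : Unit) => lfStepCap (max p 2) st) (f, []))).length ≤ _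
      set Lc := (pairE (pairE unE L) (rawE unitE) ((p, f), l₁ ++ l₂)).length with hLc
      have hP : 0 < max p 2 := lt_of_lt_of_le (by norm_num) (le_max_right _ _)
      have hrun : l₁.foldl (fun st (_ : Unit) => lfStepCap (max p 2) st) (f, []) = lfRunCap (max p 2) f l₁.length := by
        rw [lfRunCap, ← CodeFP.eq_replicate_unit l₁]
      rw [hrun]
      set st := lfRunCap (max p 2) f l₁.length with hst
      have hLf : (rawE intE f).length ≤ Lc := by
        rw [hLc]; simp only [pairE_apply, length_boolPair]; omega
      have hLfl : f.length ≤ Lc := (length_le_code f).trans hLf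
      have hLu : l₁.length ≤ Lc := by
        rw [hLc]; simp only [pairE_apply, length_boolPair]
        have := length_le_length_rawE unitE (l₁ ++ l₂); rw [List.length_append] at this; omega
      have hLp : p ≤ Lc := by rw [hLc]; simp only [pairE_apply, length_boolPair, length_unE]; omega
      -- the cofactor
      have hW : (rawE intE st.1).length ≤ 30 * (Lc + 1) ^ 4 := by
        rcases lfRunCap_fst_reduced_or_eq hP f l₁.length with h | h
        · rw [← hst] at h
          rw [h]
          have : Lc ≤ (Lc + 1) ^ 4 := (Nat.le_succ Lc).trans (Nat.le_self_pow (by norm_num) _)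
          omega
        · rw [← hst] at h
          have hlen := length_lfRunCap_fst_le (max p 2) f l₁.length
          rw [← hst] at hlen
          exact length_code_state_le h ((hlen.trans hLfl).trans (by nlinarith)) hLp
      -- the collected factors
      have hA : (rawE L st.2).length ≤ Lc * (60 * (Lc + 1) ^ 4 + 2) := by
        refine length_code_factors_le (p := p) (fun u hu => ?_) ?_ hLp
        · have := mem_lfRunCap_snd hP f l₁.length u (by rw [← hst]; exact hu)
          exact ⟨this.1, this.2.trans hLfl⟩
        · have := length_lfRunCap_snd_le (max p 2) f l₁.length
          rw [← hst] at this
          exact this.trans hLu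
      have hq1 : Lc * (60 * (Lc + 1) ^ 4 + 2) ≤ 62 * (Lc + 1) ^ 5 := by nlinarith [Nat.one_le_pow 4 (Lc + 1) (by omega)]
      have hq2 : (Lc + 1) ^ 4 ≤ (Lc + 1) ^ 5 := Nat.pow_le_pow_right (by omega) (by norm_num)
      have hq3 : 1 ≤ (Lc + 1) ^ 5 := Nat.one_le_pow _ _ (by omega)
      simp only [pairE_apply, length_boolPair, eval_mul, eval_pow, eval_add, eval_X, eval_ofNat, eval_one]
      omega)
  have hrun : CodeFP (pairE unE L) LS (fun t => lfRunCap (max t.1 2) t.2 t.2.length) :=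
    (hfold.comp ((CodeFP.id _).pair (replicateUnit.comp ((ulength intE).comp (snd _ _))))).congr fun t => by
      show (List.replicate t.2.length ()).foldl (fun st (_ : Unit) => lfStepCap (max (id t).1 2) st) ((id t).2, []) = _
      rfl
  exact hrun.snd'.congr fun t => rfl

/-- **The capped complete factorisation modulo `ℓ⁺` on codes** (`ℓ` unary), with the tree's
Berlekamp brick `berlekampFactorC`. [cite: LenstraLenstraLovasz1982, (3.1)] [cite: AroraBarak2009, §1.3] -/
theorem localFactorsCapC : CodeFP (pairE unE L) (rawE L) (fun t => localFactorsCap (max t.1 2) t.2) :=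
  localFactorsCapC_of berlekampFactorC

end Literature.NumberTheory.NumberFields
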